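import Mathlib
import Summits.ResolutionOfSingularities.ResolutionOfSingularities.Theorems.HomologicalConductorPersistenceSurfaceHullCover
import Summits.ResolutionOfSingularities.ResolutionOfSingularities.Theorems.HomologicalConductorPersistenceArenaSandwich
import Literature.RingTheory.CohomologyAnnihilator.SyzygyDescent
import Literature.RingTheory.CohomologyAnnihilator.Localization
import HarnessLib

/-!
# Rung S-2 `PersistenceSurface` (stmt-ResolutionOfSingularities-19970) — the A_r-ARRIVAL FLOOR
# `z^⌈r/2⌉ ∈ ca³(k[x,y,z]/(xy − z^{r+1}))` for EVERY `r` (`char k ≠ 2`), from the truncated principal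
# floor `p^⌊m/2⌋ ∈ ca¹(S/(pᵐ))` over a principal ideal domain

Route `ResolutionOfSingularities/HomologicalConductor`, chain W4.4b (cell res-hironaka; seat
res-L1-w44b-stub-1 gen 5, second piece of res-L1-w44b-lead-1's WAVE PLAN of 2026-08-27T17:22:33Z:
«the A_r-ARRIVAL FLOOR»). `[OURS · L1 w44b]` replaces the role of no printed item; NOT a statement of
the manuscript under review (Hironaka 2017), nothing here is attributed to its author; folklore
homological algebra, AI-written (weaker than expert review).

At a rational ARRIVAL of a surface `ca`-tower at an `A_r` point the image of the centre generator must be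
tested against `ca(A_r) = (x, y, z^⌈r/2⌉)`; the `x, y` part is the Jacobian / different floor, the sharp
`z`-part is NOT reached by any different (`∂_z = (r+1) zʳ`). This file puts the sharp `z`-floor in the
kernel at LEVEL 3 for every `r ≥ 0` and every field of characteristic `≠ 2`:

1. **Truncated principal floor** (`stablyAnnihilates_mk_pow_half`,
   `mk_pow_half_mem_cohomologyAnnihilatorOfDegree_one`): `S` a principal ideal domain, `p ∈ S`
   irreducible, `m ≥ 0`, `R = S/(pᵐ)`: **`p̄^⌊m/2⌋ ∈ ca¹(R)`**. Proof: by the structure theorem for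
   finitely generated `p^∞`-torsion modules over a PID (Mathlib's
   `Module.torsion_by_prime_power_decomposition`) every finitely generated `R`-module is
   `K ≅ ⨁ᵢ S/(p^{κᵢ})`; on a summand with `κᵢ ≤ ⌊m/2⌋` the homothety `p^⌊m/2⌋` is zero, on a summand with
   `κᵢ > ⌊m/2⌋` (so `⌊m/2⌋ + κᵢ ≥ m`) it factors as `S/(p^{κᵢ}) —p^⌊m/2⌋·—→ R —·gᵢ—→ K`; summing gives
   `π ∘ ι = p̄^⌊m/2⌋ • id_K` through the free module `R^d`, i.e. `p̄^⌊m/2⌋` STABLY ANNIHILATES every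
   finitely generated `R`-module, which is `ca¹` by CA1 (`mem_cohomologyAnnihilatorOfDegree_succ_iff_forall_isSyzygy`
   at `n = 0`). (The bound is sharp: `Ext¹_R(R/(pʲ), R/(pʲ)) ≅ R/(p^{min(j, m−j)})`; not typed here.)
2. **The truncated polynomial ring** (`X_pow_half_mem_cohomologyAnnihilatorOfDegree_one`,
   `mvPolynomial_X_pow_half_mem_cohomologyAnnihilatorOfDegree_one`): `z̄^⌊m/2⌋ ∈ ca¹(k[z]/(zᵐ))`, in the
   `Polynomial` and in the one-variable `MvPolynomial (Fin 1)` presentation (transport along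
   `map_ringEquiv_cohomologyAnnihilatorOfDegree`).
3. **The A_{m−1} surface** (`X_two_pow_half_mem_cohomologyAnnihilatorOfDegree_three`): for `char k ≠ 2`
   and `m ≥ 1`, **`z̄^⌊m/2⌋ ∈ ca³(k[x,y,z]/(xy − zᵐ))`** — stub-2's cA-ARENA SANDWICH
   `ArenaSandwich.mk_inclusion_mem_cohomologyAnnihilatorOfDegree_iff` (p552485) at `n = 0`:
   `ι c ∈ ca³(k[x,y,z]/(xy − h(z))) ↔ c̄ ∈ ca¹(k[z]/(h))`, with `h = zᵐ`. With `m = r + 1`: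
   `⌊(r+1)/2⌋ = ⌈r/2⌉`, the generator of `ca(A_r)` modulo `(x, y)`; no parity hypothesis on `r`.

References: S. B. Iyengar, R. Takahashi, *Annihilation of cohomology and strong generation of module
categories*, IMRN 2016, arXiv:1404.1476, §2 (Def. 2.1, Example 2.6, Remark 2.13) [`IyengarTakahashi2014`];
the structure theorem for finitely generated modules over a PID (Mathlib `Mathlib.Algebra.Module.PID`).
-/

-- single-problem summit: the doubled namespace component `ResolutionOfSingularities` is forced
set_option linter.dupNamespace false

noncomputable section

open CategoryTheory Literature.RingTheory.CohomologyAnnihilator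
open Summit.ResolutionOfSingularities.ResolutionOfSingularities.Theorems.NoZeno.SandwichCluster
open Summit.ResolutionOfSingularities.ResolutionOfSingularities.Theorems.HomologicalConductor.PersistenceSurfaceHullCover
open scoped DirectSum

universe u

namespace Summit.ResolutionOfSingularities.ResolutionOfSingularities.Theorems.HomologicalConductor.PersistenceArArrivalFloor

/-! ## §1 The truncated principal floor `p̄^⌊m/2⌋ ∈ ca¹(S/(pᵐ))` over a PID -/

section PID

variable {S : Type u} [CommRing S] [IsDomain S] [IsPrincipalIdealRing S]

omit [IsDomain S] [IsPrincipalIdealRing S] in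
/-- Divisibility bookkeeping: with `a = ⌊m/2⌋` and the exponent `e = if κ ≤ a then m else a`,
`pᵐ ∣ pᵉ · p^κ` (if `κ > a` then `a + κ ≥ 2a + 1 ≥ m`). [folklore] -/
theorem pow_dvd_pow_ite_mul_pow (p : S) (m κ : ℕ) :
    p ^ m ∣ p ^ (if κ ≤ m / 2 then m else m / 2) * p ^ κ := by
  split_ifs with h
  · exact dvd_mul_right _ _
  · rw [← pow_add]
    exact pow_dvd_pow p (by omega)

/-- **Truncated principal floor, stable-annihilation form.** `S` a PID, `p` irreducible, `R = S/(pᵐ)`: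
`p̄^⌊m/2⌋` stably annihilates every finitely generated `R`-module `K` — by the structure theorem
`K ≅ ⨁ᵢ S/(p^{κᵢ})` (as `S`-modules, Mathlib `Module.torsion_by_prime_power_decomposition`), and on each
cyclic summand `p^⌊m/2⌋ • id` is either zero (`κᵢ ≤ ⌊m/2⌋`) or factors through `R` by
`s̄ ↦ p^⌊m/2⌋ s` (`κᵢ > ⌊m/2⌋`); the pieces are assembled into `K —ι→ R^d —π→ K`, `π ∘ ι = p̄^⌊m/2⌋ • id`.
[folklore] -/
theorem stablyAnnihilates_mk_pow_half {p : S} (hp : Irreducible p) (m : ℕ)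
    (K : ModuleCat.{u} (S ⧸ Ideal.span {p ^ m})) [Module.Finite (S ⧸ Ideal.span {p ^ m}) K] :
    StablyAnnihilates (S ⧸ Ideal.span {p ^ m}) ((Ideal.Quotient.mk (Ideal.span {p ^ m}) p) ^ (m / 2)) K := by
  classical
  -- restriction of scalars along `S ↠ R`
  letI : Module S K := Module.compHom K (Ideal.Quotient.mk (Ideal.span {p ^ m}))
  haveI : IsScalarTower S (S ⧸ Ideal.span {p ^ m}) K :=
    IsScalarTower.of_algebraMap_smul fun _ _ => rfl
  haveI : Module.Finite S K := Module.Finite.trans (S ⧸ Ideal.span {p ^ m}) K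
  have hsmul : ∀ (s : S) (x : K), s • x = Ideal.Quotient.mk (Ideal.span {p ^ m}) s • x := fun _ _ => rfl
  have hK : Module.IsTorsion' K (Submonoid.powers p) := fun x =>
    ⟨⟨p ^ m, m, rfl⟩, by
      change (p ^ m) • x = 0
      rw [hsmul, Ideal.Quotient.eq_zero_iff_mem.mpr (Ideal.mem_span_singleton_self _), zero_smul]⟩
  obtain ⟨d, κ, ⟨e⟩⟩ := Module.torsion_by_prime_power_decomposition hp hK
  -- the generators `gᵢ = e⁻¹(δᵢ)` of the cyclic summands
  let g : Fin d → K := fun i =>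
    e.symm (DirectSum.lof S (Fin d) (fun i => S ⧸ S ∙ p ^ κ i) i (Submodule.Quotient.mk 1))
  -- `π : R^d → K`, `c ↦ Σ cᵢ gᵢ`
  let π : (Fin d → S ⧸ Ideal.span {p ^ m}) →ₗ[S ⧸ Ideal.span {p ^ m}] K :=
    Fintype.linearCombination (S ⧸ Ideal.span {p ^ m}) g
  -- `ι : K → R^d`: on the summand `S/(p^κᵢ)` multiply by `p^{exᵢ}` into `R`
  let ex : Fin d → ℕ := fun i => if κ i ≤ m / 2 then m else m / 2
  have hL : ∀ i, (S ∙ p ^ κ i) ≤ LinearMap.ker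
      (p ^ ex i • Algebra.linearMap S (S ⧸ Ideal.span {p ^ m})) := fun i => by
    rw [Submodule.span_le, Set.singleton_subset_iff, SetLike.mem_coe, LinearMap.mem_ker,
      LinearMap.smul_apply, Algebra.linearMap_apply, Algebra.smul_def, Ideal.Quotient.algebraMap_eq,
      ← map_mul, Ideal.Quotient.eq_zero_iff_mem, Ideal.mem_span_singleton]
    exact pow_dvd_pow_ite_mul_pow p m (κ i)
  let L : ∀ i, (S ⧸ S ∙ p ^ κ i) →ₗ[S] (S ⧸ Ideal.span {p ^ m}) := fun i =>
    (S ∙ p ^ κ i).liftQ (p ^ ex i • Algebra.linearMap S (S ⧸ Ideal.span {p ^ m})) (hL i)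
  let Λ : (⨁ i, S ⧸ S ∙ p ^ κ i) →ₗ[S] (Fin d → S ⧸ Ideal.span {p ^ m}) :=
    DirectSum.toModule S (Fin d) (Fin d → S ⧸ Ideal.span {p ^ m}) fun i =>
      LinearMap.single S (fun _ : Fin d => S ⧸ Ideal.span {p ^ m}) i ∘ₗ L i
  have hsurj : Function.Surjective (algebraMap S (S ⧸ Ideal.span {p ^ m})) :=
    Ideal.Quotient.mk_surjective
  let ι : K →ₗ[S ⧸ Ideal.span {p ^ m}] (Fin d → S ⧸ Ideal.span {p ^ m}) :=
    (Λ ∘ₗ e.toLinearMap).extendScalarsOfSurjective hsurj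
  refine stablyAnnihilates_of_linearMap ι π ?_
  -- the identity `π ∘ ι = p̄^a • id`, checked on the generators `e⁻¹(lof i (s̄))`, `s = 1`
  have key : ∀ i, π (ι (g i)) = (Ideal.Quotient.mk (Ideal.span {p ^ m}) p) ^ (m / 2) • g i := by
    intro i
    have hι : ι (g i) = Pi.single i (Ideal.Quotient.mk (Ideal.span {p ^ m}) (p ^ ex i)) := by
      change Λ (e (e.symm _)) = _
      rw [LinearEquiv.apply_symm_apply, DirectSum.toModule_lof, LinearMap.comp_apply,
        Submodule.liftQ_apply, LinearMap.smul_apply, Algebra.linearMap_apply, map_one,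
        Algebra.smul_def, mul_one, Ideal.Quotient.algebraMap_eq]
      rfl
    rw [hι, Fintype.linearCombination_apply_single, ← map_pow]
    by_cases h : κ i ≤ m / 2
    · -- `exᵢ = m`: the left side is `0`; the right side vanishes since `p^κᵢ ∣ p^a` kills `gᵢ`
      have hex : ex i = m := if_pos h
      rw [hex, Ideal.Quotient.eq_zero_iff_mem.mpr (Ideal.mem_span_singleton_self _), zero_smul,
        ← hsmul, ← LinearEquiv.map_smul, ← LinearMap.map_smul, ← Submodule.Quotient.mk_smul, smul_eq_mul,
        mul_one, (Submodule.Quotient.mk_eq_zero _).mpr (Ideal.mem_span_singleton.mpr (pow_dvd_pow p h)),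
        map_zero, map_zero]
    · have hex : ex i = m / 2 := if_neg h
      rw [hex]
  have hF : (π ∘ₗ ι).restrictScalars S ∘ₗ e.symm.toLinearMap =
      (((Ideal.Quotient.mk (Ideal.span {p ^ m}) p) ^ (m / 2) • LinearMap.id :
        K →ₗ[S ⧸ Ideal.span {p ^ m}] K).restrictScalars S) ∘ₗ e.symm.toLinearMap := by
    refine DirectSum.linearMap_ext S fun i => Submodule.linearMap_qext _ (LinearMap.ext_ring ?_)
    exact key i
  refine LinearMap.ext fun x => ?_
  have hx := LinearMap.congr_fun hF (e x)
  simp only [LinearMap.coe_comp, LinearMap.coe_restrictScalars, LinearEquiv.coe_coe,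
    Function.comp_apply, LinearEquiv.symm_apply_apply] at hx
  exact hx

/-- **Truncated principal floor** `p̄^⌊m/2⌋ ∈ ca¹(S/(pᵐ))` (`S` a PID, `p` irreducible): CA1 at level `1`
(`x ∈ ca¹ ↔ x` stably annihilates every finitely generated module) and `stablyAnnihilates_mk_pow_half`.
Instances: `z̄^⌊m/2⌋ ∈ ca¹(k[z]/(zᵐ))`, `p^⌊m/2⌋ ∈ ca¹(ℤ/pᵐ)`. [cite: IyengarTakahashi2014, Remark 2.13] -/
theorem mk_pow_half_mem_cohomologyAnnihilatorOfDegree_one {p : S} (hp : Irreducible p) (m : ℕ) :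
    (Ideal.Quotient.mk (Ideal.span {p ^ m}) p) ^ (m / 2) ∈
      cohomologyAnnihilatorOfDegree (S ⧸ Ideal.span {p ^ m}) 1 := by
  haveI : IsNoetherianRing (S ⧸ Ideal.span {p ^ m}) := Ideal.Quotient.isNoetherianRing _
  refine (mem_cohomologyAnnihilatorOfDegree_succ_iff_forall_isSyzygy (n := 0) _).mpr fun M K hM hK => ?_
  haveI : Module.Finite (S ⧸ Ideal.span {p ^ m}) K := finite_of_isSyzygy 0 hM hK
  exact stablyAnnihilates_mk_pow_half hp m K

end PID

/-! ## §2 The truncated polynomial ring `k[z]/(zᵐ)` -/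

section TruncatedPolynomial

open Polynomial

variable (k : Type u) [Field k] (m : ℕ)

/-- **`z̄^⌊m/2⌋ ∈ ca¹(k[z]/(zᵐ))`** (`Polynomial` presentation): `k[z]` is a PID and `z` is irreducible.
[cite: IyengarTakahashi2014, Remark 2.13] -/
theorem X_pow_half_mem_cohomologyAnnihilatorOfDegree_one :
    (Ideal.Quotient.mk (Ideal.span {(X : k[X]) ^ m}) X) ^ (m / 2) ∈
      cohomologyAnnihilatorOfDegree (k[X] ⧸ Ideal.span {(X : k[X]) ^ m}) 1 :=
  mk_pow_half_mem_cohomologyAnnihilatorOfDegree_one Polynomial.irreducible_X m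

/-- The one-variable `MvPolynomial` presentation: the algebra isomorphism `k[X] ≃ MvPolynomial (Fin 1) k`
(`MvPolynomial.uniqueAlgEquiv`, inverted) sends `X` to `X 0`. [folklore] -/
theorem uniqueAlgEquiv_symm_X :
    (MvPolynomial.uniqueAlgEquiv k (Fin 1)).symm (X : k[X]) = MvPolynomial.X 0 := by
  rw [MvPolynomial.uniqueAlgEquiv_symm_apply, Polynomial.eval₂_X, Fin.default_eq_zero]

/-- The induced isomorphism of truncations `k[X]/(Xᵐ) ≃ k[z]/(zᵐ)`, `z = X 0 ∈ MvPolynomial (Fin 1) k`: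
the ideal `(Xᵐ)` maps onto `(zᵐ)`. [folklore] -/
theorem span_X_pow_eq_map :
    Ideal.span {(MvPolynomial.X 0 : MvPolynomial (Fin 1) k) ^ m} =
      (Ideal.span {(X : k[X]) ^ m}).map
        ((MvPolynomial.uniqueAlgEquiv k (Fin 1)).symm.toRingEquiv : k[X] →+* MvPolynomial (Fin 1) k) := by
  rw [Ideal.map_span, Set.image_singleton, RingHom.coe_coe, AlgEquiv.coe_ringEquiv, map_pow,
    uniqueAlgEquiv_symm_X]

/-- **`z̄^⌊m/2⌋ ∈ ca¹(k[z]/(zᵐ))`** in the one-variable `MvPolynomial (Fin 1) k` presentation (transport of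
`X_pow_half_mem_cohomologyAnnihilatorOfDegree_one` along `Ideal.quotientEquiv`,
`ringEquiv_apply_mem_cohomologyAnnihilatorOfDegree`). [cite: IyengarTakahashi2014, Remark 2.13] -/
theorem mvPolynomial_X_pow_half_mem_cohomologyAnnihilatorOfDegree_one :
    (Ideal.Quotient.mk (Ideal.span {(MvPolynomial.X 0 : MvPolynomial (Fin 1) k) ^ m}) (MvPolynomial.X 0)) ^ (m / 2) ∈
      cohomologyAnnihilatorOfDegree
        (MvPolynomial (Fin 1) k ⧸ Ideal.span {(MvPolynomial.X 0 : MvPolynomial (Fin 1) k) ^ m}) 1 := by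
  have h := ringEquiv_apply_mem_cohomologyAnnihilatorOfDegree
    (Ideal.quotientEquiv (Ideal.span {(X : k[X]) ^ m})
      (Ideal.span {(MvPolynomial.X 0 : MvPolynomial (Fin 1) k) ^ m})
      (MvPolynomial.uniqueAlgEquiv k (Fin 1)).symm.toRingEquiv (span_X_pow_eq_map k m))
    (X_pow_half_mem_cohomologyAnnihilatorOfDegree_one k m)
  rwa [map_pow, Ideal.quotientEquiv_mk, AlgEquiv.coe_ringEquiv, uniqueAlgEquiv_symm_X] at h

end TruncatedPolynomial

/-! ## §3 The `A_{m−1}` surface `xy = zᵐ`: `z̄^⌊m/2⌋ ∈ ca³` -/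

section Surface

variable (k : Type u) [Field k] (m : ℕ)

/-- The arena inclusion `k[z] → k[x,y,z]` (`z ↦ X 2`) sends `zᵐ` to `(X 2)ᵐ`. [folklore] -/
theorem aeval_inclusion_X_pow :
    (MvPolynomial.aeval fun j : Fin (0 + 1) => (MvPolynomial.X j.succ.succ : MvPolynomial (Fin (0 + 3)) k))
        ((MvPolynomial.X 0 : MvPolynomial (Fin 1) k) ^ m) = MvPolynomial.X 2 ^ m := by
  rw [map_pow, MvPolynomial.aeval_X]
  rfl

/-- **The A_r-ARRIVAL FLOOR** (all `r`, `char k ≠ 2`): for `m ≥ 0`,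
`z̄^⌊m/2⌋ ∈ ca³(k[x,y,z]/(xy − zᵐ))` — with `m = r + 1`, `z^⌈r/2⌉ ∈ ca³(A_r)`. Proof: stub-2's cA-arena
sandwich `ArenaSandwich.mk_inclusion_mem_cohomologyAnnihilatorOfDegree_iff` (p552485) at `n = 0` reduces
it to `z̄^⌊m/2⌋ ∈ ca¹(k[z]/(zᵐ))` (`mvPolynomial_X_pow_half_mem_cohomologyAnnihilatorOfDegree_one`); the
ideal `(X 0 · X 1 − ι(zᵐ))` is rewritten to `(X 0 · X 1 − (X 2)ᵐ)` along `Ideal.quotEquivOfEq`.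
[cite: IyengarTakahashi2014, Remark 2.13] -/
theorem X_two_pow_half_mem_cohomologyAnnihilatorOfDegree_three (h2 : (2 : k) ≠ 0) :
    Ideal.Quotient.mk (Ideal.span {(MvPolynomial.X 0 * MvPolynomial.X 1 - MvPolynomial.X 2 ^ m :
        MvPolynomial (Fin 3) k)}) (MvPolynomial.X 2 ^ (m / 2)) ∈
      cohomologyAnnihilatorOfDegree (MvPolynomial (Fin 3) k ⧸
        Ideal.span {(MvPolynomial.X 0 * MvPolynomial.X 1 - MvPolynomial.X 2 ^ m : MvPolynomial (Fin 3) k)}) 3 := by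
  have hh : ((MvPolynomial.X 0 : MvPolynomial (Fin 1) k) ^ m) ≠ 0 := pow_ne_zero _ (MvPolynomial.X_ne_zero _)
  have h1 : Ideal.Quotient.mk (Ideal.span {(MvPolynomial.X 0 : MvPolynomial (Fin 1) k) ^ m})
      ((MvPolynomial.X 0 : MvPolynomial (Fin 1) k) ^ (m / 2)) ∈
      cohomologyAnnihilatorOfDegree
        (MvPolynomial (Fin 1) k ⧸ Ideal.span {(MvPolynomial.X 0 : MvPolynomial (Fin 1) k) ^ m}) (0 + 1) := by
    rw [map_pow]
    exact mvPolynomial_X_pow_half_mem_cohomologyAnnihilatorOfDegree_one k m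
  have h3 := (ArenaSandwich.mk_inclusion_mem_cohomologyAnnihilatorOfDegree_iff k 0 h2 _ hh
    ((MvPolynomial.X 0 : MvPolynomial (Fin 1) k) ^ (m / 2))).mpr h1
  have hI : Ideal.span {MvPolynomial.X 0 * MvPolynomial.X 1 -
      (MvPolynomial.aeval fun j : Fin (0 + 1) => (MvPolynomial.X j.succ.succ : MvPolynomial (Fin (0 + 3)) k))
        ((MvPolynomial.X 0 : MvPolynomial (Fin 1) k) ^ m)} =
      Ideal.span {(MvPolynomial.X 0 * MvPolynomial.X 1 - MvPolynomial.X 2 ^ m : MvPolynomial (Fin 3) k)} := by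
    rw [aeval_inclusion_X_pow]
  have h4 := ringEquiv_apply_mem_cohomologyAnnihilatorOfDegree (Ideal.quotEquivOfEq hI) h3
  rwa [Ideal.quotEquivOfEq_mk, aeval_inclusion_X_pow k (m / 2)] at h4

/-- The same at the level of the full cohomology annihilator: `z̄^⌊m/2⌋ ∈ ca(k[x,y,z]/(xy − zᵐ))`
(`char k ≠ 2`). [cite: IyengarTakahashi2014, Definition 2.1] -/
theorem X_two_pow_half_mem_cohomologyAnnihilator (h2 : (2 : k) ≠ 0) :
    Ideal.Quotient.mk (Ideal.span {(MvPolynomial.X 0 * MvPolynomial.X 1 - MvPolynomial.X 2 ^ m :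
        MvPolynomial (Fin 3) k)}) (MvPolynomial.X 2 ^ (m / 2)) ∈
      cohomologyAnnihilator (MvPolynomial (Fin 3) k ⧸
        Ideal.span {(MvPolynomial.X 0 * MvPolynomial.X 1 - MvPolynomial.X 2 ^ m : MvPolynomial (Fin 3) k)}) :=
  cohomologyAnnihilatorOfDegree_le 3 (X_two_pow_half_mem_cohomologyAnnihilatorOfDegree_three k m h2)

end Surface

end Summit.ResolutionOfSingularities.ResolutionOfSingularities.Theorems.HomologicalConductor.PersistenceArArrivalFloor

end
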